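import Summits.QuantumAdvantage.QuantumAdvantage.Theses.ArithStatLadder
import Literature.NumberTheory.QuadraticFields.ThreeTorsion
import Literature.NumberTheory.QuadraticFields.ThreeTorsionProofs
import Literature.NumberTheory.QuadraticFields.ScholzReflectionArithmetic
import Literature.NumberTheory.QuadraticFields.CubicClassFieldNormal
import Literature.NumberTheory.QuadraticFields.UnitsModCubes
import Literature.NumberTheory.QuadraticFields.SquareRootGenerator
import Literature.NumberTheory.NumberFields.ClassFieldsOfIndexThree
import Literature.NumberTheory.NumberFields.ValuationCubeClassGroup
import Literature.NumberTheory.NumberFields.AlgClosureCubeRootsOfUnity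
import Literature.NumberTheory.NumberFields.ScholzKummerGenerator
import Literature.NumberTheory.NumberFields.ScholzMirrorField
import HarnessLib

/-!
# Mirror `3`-torsion forces `3 ∣ h(−d)` (stub `stub_mirrorTorsionImpThreeDvd` of line
# `mirror-unit-signature`, crux `ArithStatLadder.AvgFaceBeyondPrior`, stmt-QuantumAdvantage-2427)

For `−d` a negative fundamental discriminant let `D⁺ = d/3` (`3 ∣ d`) resp. `3d` (`3 ∤ d`) be the
discriminant of the real mirror field `F = ℚ(√3d)`.  We prove the rank-one shadow of Scholz's
reflection inequality `r ≤ s` (Washington, *Introduction to Cyclotomic Fields*, Thm 10.10):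
`#Cl(F)[3] ≠ 1 ⟹ 3 ∣ h(−d)`.  Proof (Washington's, through the tree's PROVED class field theory):
an index-`3` subgroup of `Cl(𝓞_F)` has a cubic class field `E ⊆ F̄` (`exists_isCubicClassField`),
unramified and dihedral over `ℚ` (`CubicClassFieldNormal`); with `ζ = ζ₃ ∉ F` and `g ∈ Aut(F̄/ℚ)`,
`g|_F ≠ 1`, `g ζ = ζ²`, Scholz's Kummer generator (`exists_kummer_generator`) is a `θ ≠ 0` in the
mirror field `k = ℚ(δ(1+2ζ)) = ℚ(√−3D⁺) = ℚ(√−d)` (`δ² = D⁺`), not a cube in `F(ζ)`, with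
`(θ) = 𝔞³`; since the units `±1` of `k` (`d_k = −d < −4`) are cubes, `[𝔞] ≠ 1` is a `3`-torsion
class (`exists_subgroup_monoidHom_classGroup_of_dvd_valuation`), so `3 ∣ h_k = h(−d)` (Cox 7.7).
At `d ∈ {3, 4}` (`D⁺ ∈ {1, 12}`) the hypothesis is void.  The mirror field `ℚ(δ(1+2ζ)) = F(ζ)^g` is
`Literature/NumberTheory/NumberFields/ScholzMirrorField.lean`.

## References

* L. C. Washington, *Introduction to Cyclotomic Fields*, GTM 83, 2nd ed. (1997), Thm 10.10 and
  its proof. [Washington1997]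
* A. Scholz, J. reine angew. Math. 166 (1932), 201–203. [Scholz1932]
-/

noncomputable section

-- the summit-side namespace `Summit.QuantumAdvantage.QuantumAdvantage.…` (summit = problem) is mandated by the layout
set_option linter.dupNamespace false

namespace Summit.QuantumAdvantage.QuantumAdvantage.Theorems.AvgFaceBeyondPrior.Mirror

open Literature.NumberTheory.QuadraticFields
open Literature.NumberTheory.NumberFields
open NumberField Module IsDedekindDomain WithZero
open scoped IntermediateField

/-! ### The stub -/

/-- **Mirror `3`-torsion forces `3 ∣ h(−d)`** (the rank-one shadow of Scholz's `r ≤ s`,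
Washington GTM 83 Thm 10.10): for `−d` a negative fundamental discriminant, a non-trivial
`3`-torsion ideal class of the real mirror field `ℚ(√3d)` (discriminant `D⁺ = d/3` or `3d`) forces
`3 ∣ h(−d)`.  Proof: cubic class field of `ℚ(√D⁺)` (Artin reciprocity) → Scholz's Kummer generator
`θ` in the mirror field `ℚ(√−3D⁺) = ℚ(√−d)` with `(θ) = 𝔞³`, `θ ∉ ℚ(√D⁺, ζ₃)׳` → `[𝔞] ≠ 1`
since the units `±1` of `ℚ(√−d)` are cubes.  (At `d ∈ {3, 4}`, `D⁺ ∈ {1, 12}` and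
`quadFieldThreeTorsion D⁺ = 1`: the hypothesis is void.) [cite: Washington1997, Thm 10.10 (proof)] -/
theorem stub_mirrorTorsionImpThreeDvd :
    ∀ d : ℕ, ((((-(d:ℤ)) % 4 = 1 ∧ Squarefree (-(d:ℤ)) ∧ (-(d:ℤ)) ≠ 1) ∨
        (4 ∣ (-(d:ℤ)) ∧ ((-(d:ℤ)) / 4 % 4 = 2 ∨ (-(d:ℤ)) / 4 % 4 = 3) ∧ Squarefree ((-(d:ℤ)) / 4)))) →
      quadFieldThreeTorsion (if 3 ∣ d then ((d / 3 : ℕ) : ℤ) else 3 * (d : ℤ)) ≠ 1 →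
        3 ∣ BinaryQuadraticForm.classNumber (-(d:ℤ)) := by
  intro d hd ht
  classical
  -- the degenerate points `d = 3` (`D⁺ = 1`) and `d = 4` (`D⁺ = 12`); so `4 < d`
  have hd3 : d ≠ 3 := by
    rintro rfl
    apply ht
    rw [if_pos (dvd_refl 3), Nat.div_self (by norm_num), Nat.cast_one]
    exact quadFieldThreeTorsion_one
  have hd4 : d ≠ 4 := by
    rintro rfl
    apply ht
    rw [if_neg (by norm_num : ¬ 3 ∣ 4)]
    exact quadFieldThreeTorsion_eq_one_of_mem (Or.inr (Or.inr (by norm_num)))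
  have hd4' : 4 < d := by rcases hd with ⟨h1, -, -⟩ | ⟨h4', hres, -⟩ <;> omega
  -- `-3·D⁺ = -d·s²` with `s ∈ {1, 3}`: the mirror field `ℚ(√-3D⁺)` is `ℚ(√-d)`
  obtain ⟨s, hs⟩ : ∃ s : ℚ, (-3 : ℚ) * ((if 3 ∣ d then ((d / 3 : ℕ) : ℤ) else 3 * (d : ℤ) : ℤ) : ℚ) =
      ((-(d:ℤ) : ℤ) : ℚ) * s ^ 2 := by
    by_cases h3d : 3 ∣ d
    · refine ⟨1, ?_⟩
      rw [if_pos h3d]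
      obtain ⟨e, rfl⟩ := h3d
      rw [Nat.mul_div_cancel_left e (by norm_num)]
      push_cast
      ring
    · exact ⟨3, by rw [if_neg h3d]; push_cast; ring⟩
  -- the mirror discriminant `D` and the real quadratic field `F` of discriminant `D`
  set D : ℤ := (if 3 ∣ d then ((d / 3 : ℕ) : ℤ) else 3 * (d : ℤ)) with hDdef
  have hDfund : (D % 4 = 1 ∧ Squarefree D ∧ D ≠ 1) ∨
      (4 ∣ D ∧ (D / 4 % 4 = 2 ∨ D / 4 % 4 = 3) ∧ Squarefree (D / 4)) := by
    have h := isFundamental_mirrorDisc hd hd3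
    rwa [← hDdef] at h
  have hDpos : 0 < D := by
    rw [hDdef]
    split_ifs with h
    · have : 0 < d / 3 := Nat.div_pos (by omega) (by norm_num)
      exact_mod_cast this
    · omega
  obtain ⟨F, _, _, h2, hdiscF⟩ := Quadratic.exists_numberField_discr_eq hDfund
  -- an index-`3` subgroup of `Cl(𝓞 F)` (`#Cl[3] = 2·#{index-3 subgroups} + 1 ≠ 1`)
  obtain ⟨S, hS⟩ : ∃ S : Subgroup (ClassGroup (𝓞 F)), S.index = 3 := by
    have h := quadFieldThreeTorsion_eq_two_mul_card_index_three_add_one D F h2 hdiscF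
    have hne : Nat.card {H : Subgroup (ClassGroup (𝓞 F)) // H.index = 3} ≠ 0 := fun h0 => by
      rw [h0] at h
      exact ht h
    obtain ⟨⟨S, hS⟩⟩ := (Nat.card_ne_zero.mp hne).1
    exact ⟨S, hS⟩
  -- the cubic class field `E` of `S` (Artin reciprocity)
  obtain ⟨E, hEfd, hEgal, hE3, hEunr, ψ, χ, -, hχ, hfrob⟩ := exists_isCubicClassField hS
  haveI := hEfd
  haveI := hEgal
  -- `F/ℚ` is Galois
  haveI : Algebra.IsQuadraticExtension ℚ F := ⟨h2⟩
  haveI : IsGalois ℚ F := inferInstance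
  -- `ζ = ζ₃ ∈ F̄`, `ζ ∉ F` (`d_F = D ≠ -3`), and `g ∈ Aut(F̄/ℚ)` with `g|_F ≠ 1`, `g ζ = ζ²`
  obtain ⟨ζ, hζ⟩ : ∃ ζ : AlgebraicClosure F, IsPrimitiveRoot ζ 3 :=
    HasEnoughRootsOfUnity.exists_primitiveRoot (AlgebraicClosure F) 3
  have hD3 : NumberField.discr F ≠ -3 := by rw [hdiscF]; omega
  have hζF : ζ ∉ Set.range (algebraMap F (AlgebraicClosure F)) :=
    not_mem_range_algebraMap_of_isPrimitiveRoot h2 hD3 hζ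
  obtain ⟨g, hgF, hgζ⟩ := exists_algEquiv_restrictNormal_ne_one hζ hζF h2
  -- `δ = √D ∈ F`
  obtain ⟨δ, hδ, hδ2⟩ := Quadratic.exists_not_mem_range_sq_eq_discr h2
  rw [hdiscF] at hδ2
  -- the mirror field `k = ℚ(η)`, `η = δ(1 + 2ζ)`, `η² = -3D`
  set η : AlgebraicClosure F := algebraMap F (AlgebraicClosure F) δ * (1 + 2 * ζ) with hηdef
  set k : IntermediateField ℚ (AlgebraicClosure F) := ℚ⟮η⟯ with hkdef
  have h2k : finrank ℚ k = 2 := finrank_adjoin_eta hζ hζF hδ hδ2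
  haveI : FiniteDimensional ℚ k := Module.finite_of_finrank_eq_succ h2k
  haveI hknf : NumberField k := NumberField.of_module_finite ℚ _
  have hkM : ∀ x : AlgebraicClosure F, x ∈ k → x ∈ F⟮ζ⟯ := fun x hx =>
    mem_adjoin_of_mem_adjoin_eta hx
  have hMk : ∀ x ∈ F⟮ζ⟯, g x = x → x ∈ k := fun x hx hgx =>
    mem_adjoin_eta_of_apply_eq h2 hζ hζF hgF hgζ hδ hδ2 hx hgx
  -- `E` is `g`-stable and `g` inverts `Gal(E/F)` (the class fields of a quadratic field are dihedral)
  have hgE : ∀ x ∈ E, g x ∈ E := fun x hx => apply_mem_of_frobData h2 hEunr hχ hfrob g hx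
  have hinv : ∀ (h : AlgebraicClosure F ≃ₐ[F] AlgebraicClosure F), ∀ y ∈ E,
      g (h y) = h.symm (g y) :=
    fun h y hy => apply_apply_eq_symm_apply_of_frobData h2 hEunr hχ hfrob g hgF h hy
  -- Scholz's Kummer generator: `θ ∈ k`, `θ ≠ 0`, not a cube in `F(ζ)`, `3 ∣ v(θ)` for all `v`
  obtain ⟨θ, lam, hθ0, -, -, hθnc, -, hval⟩ :=
    exists_kummer_generator h2 hζ hζF hgζ k hkM hMk E hE3 hEunr hgE hinv
  -- `d_k = -d`
  set ηk : k := ⟨η, IntermediateField.mem_adjoin_simple_self ℚ η⟩ with hηkdef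
  have hηk : ηk ∉ Set.range (algebraMap ℚ k) := by
    rintro ⟨q, hq⟩
    apply eta_not_mem_range hζF hδ
    refine ⟨q, ?_⟩
    have h := congrArg (fun z : k => (z : AlgebraicClosure F)) hq
    rw [IsScalarTower.algebraMap_apply ℚ k (AlgebraicClosure F) q]
    exact h
  have hηk2 : ηk ^ 2 = algebraMap ℚ k (-3 * (D : ℚ)) := by
    apply Subtype.ext
    rw [SubmonoidClass.coe_pow]
    change η ^ 2 = ((algebraMap ℚ k (-3 * (D : ℚ)) : k) : AlgebraicClosure F)
    rw [hηdef, eta_sq hζ hζF hδ2, eq_ratCast, eq_ratCast]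
    push_cast
    rfl
  obtain ⟨q, -, hq⟩ := NumberField.exists_discr_eq_mul_sq h2k hηk hηk2
  have hdisck : NumberField.discr k = -(d:ℤ) :=
    Quadratic.eq_of_isFundamental_of_eq_mul_sq (Quadratic.isFundamentalDiscriminant_discr h2k) hd
      (q := s * q) (by rw [hq]; linear_combination q ^ 2 * hs)
  -- the class of the cube-root ideal `𝔞` of `(θ) = 𝔞³` is a non-trivial `3`-torsion class
  obtain ⟨W, hW, φ, hφ3, hker⟩ :=
    exists_subgroup_monoidHom_classGroup_of_dvd_valuation (R := 𝓞 k) k (n := 3) three_ne_zero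
  have hΘW : Units.mk0 θ hθ0 ∈ W := (hW _).mpr fun v => hval v
  have hφne : φ ⟨Units.mk0 θ hθ0, hΘW⟩ ≠ 1 := by
    intro h1
    obtain ⟨u, z, huz⟩ := (hker ⟨Units.mk0 θ hθ0, hΘW⟩).mp h1
    -- the units of `k` are `±1` (`d_k = -d < -4`)
    obtain ⟨T⟩ := Quadratic.nonempty_tauData (K := k) h2k
    have hDk : NumberField.discr k < -4 := by rw [hdisck]; omega
    have hu := Quadratic.TauData.units_eq_one_or_neg_one T h2k hDk u
    have hθeq : θ = algebraMap (𝓞 k) k (u : 𝓞 k) * (z : k) ^ 3 := by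
      have h : ((Units.mk0 θ hθ0 : kˣ) : k) =
          ((Units.map (algebraMap (𝓞 k) k : 𝓞 k →* k) u * z ^ 3 : kˣ) : k) :=
        congrArg Units.val huz
      rw [Units.val_mk0, Units.val_mul, Units.coe_map, MonoidHom.coe_coe,
        Units.val_pow_eq_pow_val] at h
      exact h
    obtain ⟨ε, hε, hε3⟩ : ∃ ε : k, algebraMap (𝓞 k) k (u : 𝓞 k) = ε ∧ ε ^ 3 = ε := by
      rcases hu with h | h
      · exact ⟨1, by rw [h, map_one], by norm_num⟩
      · exact ⟨-1, by rw [h, map_neg, map_one], by norm_num⟩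
    -- so `θ = (ε z)³` is a cube in `k ⊆ F(ζ)`
    refine hθnc ((ε * (z : k) : k) : AlgebraicClosure F) (hkM _ (SetLike.coe_mem _)) ?_
    rw [← SubmonoidClass.coe_pow]
    congr 1
    rw [mul_pow, hε3, ← hε]
    exact hθeq.symm
  have hlt : 1 < Nat.card {c : ClassGroup (𝓞 k) // c ^ 3 = 1} := by
    rw [Finite.one_lt_card_iff_nontrivial]
    exact ⟨⟨φ ⟨Units.mk0 θ hθ0, hΘW⟩, hφ3 _⟩, ⟨1, one_pow 3⟩,
      fun h => hφne (congrArg Subtype.val h)⟩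
  have h3k : 3 ∣ NumberField.classNumber k := (three_dvd_classNumber_iff_one_lt_natCard k).mpr hlt
  -- `h_k = h(-d)` (Cox Thm 7.7)
  have hneg : NumberField.discr k < 0 := by rw [hdisck]; omega
  rw [← hdisck, Quadratic.card_reducedForms_eq_classNumber h2k hneg]
  exact h3k

end Summit.QuantumAdvantage.QuantumAdvantage.Theorems.AvgFaceBeyondPrior.Mirror

end
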